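import Summits.ResolutionOfSingularities.ResolutionOfSingularities.Theorems.FrameStep3

/-!
# FrameStep (slice 4/4: the frame step)

Continuation of `Theorems.FrameStep3` ((M-Dict) TOOL of the `decomp-res` cell, lens-5 g39, toward
`TightDefectClasses.TowerDictionary`; see the module docstring of `Theorems.FrameStep1` for the architecture).

This slice: `frame_step` — THE one-step stage dictionary on inhabited data: from an injective frame `θ`
centred in a local `K`-rational subring `B' ⊆ L` that is a certified point blow-up chart of `B(θ)` along the
origin (`ShallowPort.PointBlowupCert`), a residual polynomial `s.F` of order `≥ q = p^e` and the
controlled-transform law `θ(Z^q + s.F) = c_j^q · g`, `g ∈ 𝔪_{B'}`, it produces `j`, `b` (`b_j = 0`) and an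
injective frame `θ⁺` with `B(θ⁺) = B'`, centred in `B'`, `θ⁺(u_j) = θ(u_j)`, and
`θ⁺(Z^q + (step q j b s).F) = v · g` (`v` a unit); if `g ∈ 𝔪_{B'}^q` then `IsEquimultiplePoint q j b s`
and `(step q j b s).F` has order `≥ q` again.

Sanity instance (paper standard; critic letter 238a (f4)).  `p = q = 2`, `K = 𝔽̄₂`, `σ = Fin 2`,
`F = u₁² u₂` (`a + b = 3 ≥ q + 1`), `f = Z² + u₁²u₂`, `L = K(Z,u₁,u₂)`, `θ = ` the inclusion, so
`B(θ) = K[Z,u]_{(Z,u)}`.  The `u₁`-chart `Z = u₁Z'`, `u₂ = u₁u₂'`: `B' = K[Z',u₁,u₂']_{(Z',u₁,u₂')}`, certificate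
`r = 3`, `c = (Z,u₁,u₂)`, `c_j = u₁` (`chartClosure = B(θ)[Z/u₁, u₂/u₁]`, `B'` a localisation of it, `frac` ✓),
`θ(f) = u₁²·(Z'² + u₁u₂')`, i.e. `c = u₁`, `g = Z'² + u₁u₂' ∈ 𝔪_{B'}`; `chartTransform 2 1 F = u₁u₂`
(`(2,1) ↦ (3-2, 1)`).  The `Z`-chart is excluded: there `f = Z²(1 + Z u₁''²u₂'')` is `Z² · unit`, which is what
`exists_unit_ratio` rules out for `g ∈ 𝔪`.  At the origin `b = 0` of the `u₁`-chart: `θ⁺ : Z ↦ Z', u₁ ↦ u₁,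
u₂ ↦ u₂'`, `B(θ⁺) = B'`, `h = 0`, `θ⁺(Z² + u₁u₂) = g` (`v = 1`); `g ∈ 𝔪_{B'}²`, and indeed `u₁u₂` has no
monomial of degree `< 2`: `IsEquimultiplePoint 2 1 0 s`, `F' = deletePthPowers 2 (u₁u₂) = u₁u₂` of order `2 ≥ q`.
At the points `b = (0, β)`, `β ≠ 0`, of the exceptional divisor: `translate b (u₁u₂) = βu₁ + u₁u₂` has the
degree-1 term `βu₁`, not equimultiple — matching `g = Z'² + u₁(u₂'' + β) ∉ 𝔪_b²` (order 1 upstairs).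
-/

set_option linter.dupNamespace false

open MvPolynomial
open Literature.AlgebraicGeometry.Resolution
open Literature.AlgebraicGeometry.Resolution.Hauser2010
open Literature.AlgebraicGeometry.Resolution.PointBlowup
open Summit.ResolutionOfSingularities.ResolutionOfSingularities.Theorems.ShallowPort

namespace Summit.ResolutionOfSingularities.ResolutionOfSingularities.Theorems.FrameStep

noncomputable section

variable {σ : Type} [Fintype σ] [DecidableEq σ] {K : Type} [Field K]

section Step

variable {L : Type} [Field L] [Algebra K L] {B' : Subring L}

/-! ### The frame step -/

/-- **THE FRAME STEP** (one-step stage dictionary on inhabited data).  Let `θ : K[Z,u] → L` be an injective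
frame centred in the local subring `B' ⊆ L` (`θ(X o) ∈ 𝔪_{B'}`) whose residue field is `K`, let
`B(θ) → B'` be a point blow-up chart along the origin ideal (certificate `cert`, exceptional generator
`c = c_j`), and suppose the frame polynomial `f = Z^q + F(u)` (`q = p^e`, all monomials of `F` of degree
`≥ q`) satisfies `θ(f) = c^q · g` with `g ∈ 𝔪_{B'}` (the controlled transform).  Then there are a direction
`j`, a centre `b` with `b_j = 0` and a NEW injective frame `θ⁺` with `B(θ⁺) = B'`, centred in `B'`, whose frame
polynomial is the walk's next stage `Z^q + (step q j b s).F` up to a unit: `θ⁺(Z^q + (step q j b s).F) = v·g`;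
and if moreover `g ∈ 𝔪_{B'}^q` (order `≥ q` at the new point) then `(j, b)` is an equimultiple point of `s`
and the new residual polynomial again has all monomials of degree `≥ q`. -/
theorem frame_step (p : ℕ) [Fact p.Prime] [CharP K p] [PerfectField K] [DecidableEq K] (e : ℕ)
    [IsLocalRing B'] (θ : MvPolynomial (Option σ) K →ₐ[K] L) (hθ : Function.Injective θ)
    (hloc : ∀ o, θ (X o) ∈ maxSet B') (hrat : ∀ w ∈ B', ∃ c : K, w - algebraMap K L c ∈ maxSet B')
    (cert : PointBlowupCert (frameRing θ hθ) B' (originIdeal θ hθ))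
    (s : State σ K) (hs : ∀ d ∈ s.F.support, p ^ e ≤ d.degree)
    (g : L) (hg : g ∈ maxSet B')
    (hfg : θ (framePoly (p ^ e) s.F) = ((cert.c cert.j : frameRing θ hθ) : L) ^ p ^ e * g) :
    ∃ (j : σ) (b : σ → K) (θ' : MvPolynomial (Option σ) K →ₐ[K] L) (hθ' : Function.Injective θ'),
      b j = 0 ∧ frameRing θ' hθ' = B' ∧ θ' (X (some j)) = θ (X (some j)) ∧ (∀ o, θ' (X o) ∈ maxSet B') ∧
      (∃ v ∈ unitSet B', θ' (framePoly (p ^ e) (step (p ^ e) j b s).F) = v * g) ∧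
      ((∃ hg' : g ∈ B', (⟨g, hg'⟩ : B') ∈ IsLocalRing.maximalIdeal B' ^ p ^ e) →
        IsEquimultiplePoint (p ^ e) j b s ∧ ∀ d ∈ (step (p ^ e) j b s).F.support, p ^ e ≤ d.degree) := by
  have hp : p.Prime := Fact.out
  set q := p ^ e with hq_def
  have hq1 : 1 ≤ q := Nat.succ_le_of_lt (pow_pos hp.pos e)
  have hBB' : frameRing θ hθ ≤ B' := le_trans (fun x hx => Subring.subset_closure (Or.inl hx)) cert.le
  have hK : ∀ c : K, algebraMap K L c ∈ B' := fun c => hBB' (algebraMap_mem_frameRing θ hθ c)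
  set c := ((cert.c cert.j : frameRing θ hθ) : L) with hc_def
  have hc0 : c ≠ 0 := fun h => cert.ne_zero (Subtype.ext h)
  obtain ⟨hdiv, o₀, ho₀⟩ := exists_coordinate_unit θ hθ cert
  obtain ⟨j, hju⟩ := exists_unit_ratio θ hθ hK hloc q hq1 s.F hs c hc0 hdiv o₀ ho₀ g hg hfg
  -- the chart frame `θ'`
  set θ' := chartFrame θ j with hθ'_def
  have hθ'i : Function.Injective θ' := chartFrame_injective θ hθ j
  have hXj0 : θ (X (some j)) ≠ 0 := (map_ne_zero_iff θ hθ).mpr (X_ne_zero _)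
  have hwinv : c / θ (X (some j)) ∈ unitSet B' := by
    have := inv_mem_unitSet hju
    rwa [inv_div] at this
  have hθ'B : ∀ o, θ' (X o) ∈ B' := by
    intro o
    by_cases ho : o = some j
    · rw [ho, hθ'_def, chartFrame_X_self]
      exact (hloc _).1
    · rw [hθ'_def, chartFrame_X_of_ne θ j ho]
      have he : θ (X o) / θ (X (some j)) = θ (X o) / c * (c / θ (X (some j))) := by
        field_simp
      rw [he]
      exact mul_mem (hdiv o) hwinv.1
  have hθθ' : ∀ P, θ P = θ' (blowSubst K (some j) P) := fun P => by
    rw [← AlgHom.comp_apply, hθ'_def, chartFrame_comp θ hθ j]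
  -- the centre `b`
  obtain ⟨b, hbj, hb⟩ := exists_centre hrat θ' hθ'B j (by rw [hθ'_def, chartFrame_X_self]; exact hloc _)
  -- cleaning: `(step q j b s).F = translate b G + h^q`
  obtain ⟨h, hh⟩ := exists_add_pow_eq_deletePthPowers p e (pointTransform q j b s)
  have hD : PointBlowup.translate b (chartTransform q j s.F) + h ^ p ^ e = (step q j b s).F := hh
  -- the re-centred frame `θ⁺ = θ' ∘ unshift`
  set θp := θ'.comp (unshift b h) with hθp_def
  have hθpi : Function.Injective θp := hθ'i.comp (unshift_injective b h)
  have hθ'θp : ∀ P, θ' P = θp (shift b h P) := fun P => by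
    rw [hθp_def, AlgHom.comp_apply, unshift_shift]
  have hθpm : ∀ m, θp (X (some m)) = θ' (X (some m)) - algebraMap K L (b m) := fun m => by
    rw [hθp_def, AlgHom.comp_apply, unshift_X_some, map_sub, algHom_C]
  -- the frame polynomial identity
  have hfp : θp (framePoly q (step q j b s).F) = θ' (framePoly q (chartTransform q j s.F)) :=
    comp_unshift_framePoly p e θ' b h _ _ hD
  have hff' : θ (framePoly q s.F) = θ (X (some j)) ^ q * θ' (framePoly q (chartTransform q j s.F)) := by
    rw [hθθ' (framePoly q s.F), blowSubst_framePoly j q s.F hs, map_mul, map_pow, hθ'_def, chartFrame_X_self]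
  have hvg : θp (framePoly q (step q j b s).F) = (c / θ (X (some j))) ^ q * g := by
    have hXq : θ (X (some j)) ^ q ≠ 0 := pow_ne_zero _ hXj0
    rw [hfp, div_pow, div_mul_eq_mul_div, eq_div_iff hXq, ← hfg, hff', mul_comm]
  have hv : (c / θ (X (some j))) ^ q ∈ unitSet B' := pow_mem_unitSet q hwinv
  -- the new frame is centred in `B'`
  have hφ : ∀ m : σ, (θp.comp (rename some)) (X m) ∈ maxSet B' := fun m => by
    rw [AlgHom.comp_apply, rename_X, hθpm]
    exact hb m
  have hθpB : ∀ Q : MvPolynomial σ K, θp (rename some Q) ∈ B' := fun Q =>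
    (eval_mem_and_congr (θp.comp (rename some)) hK hφ Q).1
  have hvars : ∀ o, θp (X o) ∈ maxSet B' := by
    intro o
    rcases o with _ | m
    · have hZeq : θp (X none) = θ' (X none) - θp (rename some h) := by
        rw [hθp_def, AlgHom.comp_apply, AlgHom.comp_apply, unshift_X_none, unshift_rename, map_sub]
      have hZB : θp (X none) ∈ B' := by
        rw [hZeq]
        exact sub_mem (hθ'B none) (hθpB h)
      refine mem_maxSet_of_pow_mem (n := q) hZB ?_
      have hZq : θp (X none) ^ q = (c / θ (X (some j))) ^ q * g - θp (rename some (step q j b s).F) := by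
        rw [← hvg, framePoly, map_add, map_pow]
        ring
      rw [hZq]
      refine sub_mem_maxSet (mul_mem_maxSet_left hv.1 hg) ?_
      have hD0 : (step q j b s).F ∈ idealOfVars σ K := by
        rw [mem_idealOfVars_iff, constantCoeff_eq, show (step q j b s).F = deletePthPowers q (pointTransform q j b s)
          from rfl, coeff_deletePthPowers, if_pos]
        intro i hi
        simp at hi
      have := eval_mem_maxSet_of_mem (θp.comp (rename some)) hK hφ hD0
      rwa [AlgHom.comp_apply] at this
    · rw [hθpm]
      exact hb m
  -- `B(θ⁺) = B'`
  have hθrange : ∀ P, θ P ∈ frameRing θp hθpi := fun P => by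
    rw [hθθ', hθ'θp]
    exact map_mem_frameRing θp hθpi _
  have hθ'range : ∀ P, θ' P ∈ frameRing θp hθpi := fun P => by
    rw [hθ'θp]
    exact map_mem_frameRing θp hθpi _
  have hsub : frameRing θ hθ ≤ frameRing θp hθpi := by
    intro x hx
    obtain ⟨a, t, ht, rfl⟩ := (mem_frameRing_iff θ hθ).mp hx
    exact div_mem_frameRing θp hθpi hK hvars (hθrange a) (hθrange t) (eval_mem_unitSet_of_not_mem θ hK hloc ht)
  have hratio : ∀ o, θ (X o) / θ (X (some j)) ∈ frameRing θp hθpi := by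
    intro o
    by_cases ho : o = some j
    · rw [ho, div_self hXj0]
      exact one_mem _
    · rw [← chartFrame_X_of_ne θ j ho, ← hθ'_def]
      exact hθ'range _
  have horig : ∀ y : frameRing θ hθ, y ∈ originIdeal θ hθ → (y : L) / θ (X (some j)) ∈ frameRing θp hθpi := by
    intro y hy
    obtain ⟨a, ha⟩ := Ideal.mem_span_range_iff_exists_fun.mp hy
    have hval : (y : L) = ∑ o, ((a o : frameRing θ hθ) : L) * θ (X o) := by
      have := congrArg Subtype.val ha
      simpa using this.symm
    rw [hval, Finset.sum_div]
    exact sum_mem fun o _ => by rw [mul_div_assoc]; exact mul_mem (hsub (a o).2) (hratio o)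
  have hcmem : ∀ l, (cert.c l : frameRing θ hθ) ∈ originIdeal θ hθ := fun l => by
    have h0 : cert.c l ∈ Ideal.span (Set.range cert.c) := Ideal.subset_span ⟨l, rfl⟩
    rwa [cert.span_eq] at h0
  have hwmem : θ (X (some j)) / c ∈ frameRing θp hθpi := by
    rw [← one_div_div]
    exact div_mem_frameRing θp hθpi hK hvars (one_mem _) (horig _ (hcmem cert.j)) hwinv
  have hC : chartClosure (frameRing θ hθ) cert.c cert.j ≤ frameRing θp hθpi := by
    rw [chartClosure]
    refine Subring.closure_le.mpr ?_
    rintro x (hx | ⟨y, ⟨l, rfl⟩, rfl⟩)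
    · exact hsub hx
    · show ((cert.c l : frameRing θ hθ) : L) / c ∈ frameRing θp hθpi
      have he : ((cert.c l : frameRing θ hθ) : L) / c
          = ((cert.c l : frameRing θ hθ) : L) / θ (X (some j)) * (θ (X (some j)) / c) := by
        field_simp
      rw [he]
      exact mul_mem (horig _ (hcmem l)) hwmem
  have hB : frameRing θp hθpi = B' :=
    le_antisymm (frameRing_le θp hθpi hK hvars) (le_frameRing_of_frac θp hθpi hK hvars _ hC cert.frac)
  -- assemble
  refine ⟨j, b, θp, hθpi, hbj, hB, ?_, hvars, ⟨_, hv, hvg⟩, fun hgq => ?_⟩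
  · rw [hθpm, hbj, map_zero, sub_zero, hθ'_def, chartFrame_X_self]
  -- equimultiplicity from `g ∈ 𝔪^q`
  obtain ⟨hgB, hgq⟩ := hgq
  have hfq : framePoly q (step q j b s).F ∈ idealOfVars (Option σ) K ^ q := by
    refine mem_pow_idealOfVars_of_mem_pow θp hθpi hB q _ ⟨hB.le (map_mem_frameRing θp hθpi _), ?_⟩
    have he : (⟨θp (framePoly q (step q j b s).F), hB.le (map_mem_frameRing θp hθpi _)⟩ : B')
        = ⟨(c / θ (X (some j))) ^ q, hv.1⟩ * ⟨g, hgB⟩ := Subtype.ext hvg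
    rw [he]
    exact Ideal.mul_mem_left _ _ hgq
  have hZq : X none ^ q ∈ idealOfVars (Option σ) K ^ q :=
    Ideal.pow_mem_pow ((mem_idealOfVars_iff _).mpr (constantCoeff_X K none)) q
  have hDq : rename some (step q j b s).F ∈ idealOfVars (Option σ) K ^ q := by
    have := Ideal.sub_mem _ hfq hZq
    rwa [framePoly, add_sub_cancel_left] at this
  have hdeg : ∀ d ∈ (step q j b s).F.support, q ≤ d.degree := by
    intro d hd
    have hd' : Finsupp.mapDomain some d ∈ (rename some (step q j b s).F).support := by
      rw [support_rename_of_injective (Option.some_injective σ)]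
      exact Finset.mem_image_of_mem _ hd
    have := (mem_pow_idealOfVars_iff q _).mp hDq _ hd'
    rwa [Finsupp.degree_mapDomain] at this
  refine ⟨fun d hd0 hdq => ?_, hdeg⟩
  have hcoeff : coeff d (step q j b s).F = 0 := by
    by_contra hne
    exact absurd (hdeg d (mem_support_iff.mpr hne)) (not_le.mpr hdq)
  rw [show (step q j b s).F = deletePthPowers q (pointTransform q j b s) from rfl, coeff_deletePthPowers] at hcoeff
  by_cases hP : IsPthPowerExponent q d
  · exfalso
    obtain ⟨i, hi⟩ : ∃ i, d i ≠ 0 := by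
      by_contra hall
      push Not at hall
      exact hd0 (Finsupp.ext hall)
    have hdvd : q ∣ d i := (isPthPowerExponent_iff q d).mp hP i
    have hle : q ≤ d i := Nat.le_of_dvd (Nat.pos_of_ne_zero hi) hdvd
    exact absurd (hle.trans (Finsupp.le_degree i d)) (not_le.mpr hdq)
  · rwa [if_neg hP] at hcoeff

end Step

end

end Summit.ResolutionOfSingularities.ResolutionOfSingularities.Theorems.FrameStep
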